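import Summits.CriticalPhenomena.Ising3DConformalLimit.Theses.CoerciveSharpness
import Summits.CriticalPhenomena.Ising3DConformalLimit.Theorems.GaussianLimitNotScreened.Negative.ModelBlindSharp
import HarnessLib

/-!
# `WindowForcesU4` (stmt-CriticalPhenomena-5505) is MODEL-BLIND-FALSE

Negative knowledge about the crux `…Theses.CoerciveSharpness.WindowForcesU4` (shared verbatim with
`…Theses.LatticeSDPCertificates.WindowForcesU4`), standing crux disprover (cdisprove, D-0016);
THEOREM-ONLY in spirit (two bookkeeping `def`s), supports the item, closes nothing.

The crux reads: WINDOW for the critical two-point function along `e₁`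
(`∃ ε c > 0, ∀ 1 ≤ m ≤ n, c (n/m)^{-(3/2-ε)} G(m e₁) ≤ G(n e₁)`, `G = criticalTwoPoint 3`) implies that
every non-degenerate pointwise scaling limit of `criticalCorr 3` has `U₄ ≢ 0`. Hypothesis AND conclusion
see the Ising model only through the lattice family `criticalCorr 3`
(`criticalTwoPoint 3 x = criticalCorr 3 2 ![0, x]`, `criticalCorr_two`): `WindowForcesU4For G` is the
same sentence for an arbitrary `G : LatticeCorrFamily 3`, and
`windowForcesU4_iff_for_criticalCorr : WindowForcesU4 ↔ WindowForcesU4For (criticalCorr 3)`.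

* `not_windowForcesU4For_gffLattice` — for EVERY `Δ < 3/4` the generalised free field sampled on `ℤ³`
  (`gffLattice Δ` of `GaussianLimitNotScreened/Negative/ModelBlindSharp.lean`: two-point function
  `‖a - b‖₂^{-2Δ}`, Wick four-point function) satisfies WINDOW with room `ε = 3/2 - 2Δ` and constant
  `c = 1` — with EQUALITY along the axis (`gffLattice_two_axis`, `gffLattice_latticeWindow`) —, has the
  genuine pointwise scaling limit `gffFamily Δ` under `ρ δ = δ^{-Δ}` (`gffLattice_hasLimit`; Möbius
  covariant, non-degenerate) and `U₄ ≡ 0` (`not_hasNontrivialU4_gff`). So `WindowForcesU4For (gffLattice Δ)`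
  is false; `Δ ∈ [1/2, 3/4)` covers the whole Ising window of Duminil-Copin–Panis 2025, Thm 1.5
  (`dimension_window_and_eta`: `Δ ∈ [1/2, 3/4]`) except its upper endpoint, where WINDOW itself fails
  (`not_windowBelowHalf_of_hasIsingEtaBounds_half`).
* `not_forall_windowForcesU4For` — hence the crux has no "two-point information + existence of the
  limit" proof: WINDOW is an input to, not a substitute for, a four-point LOWER bound.
* `not_windowForcesU4ForIsingLike` — the sharpening: even for lattice families that are translation
  invariant, pair-symmetric, odd-free, GAUSSIAN ON THE LATTICE (`U₄^{ℤ³} ≡ 0`, compatible with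
  Lebowitz' `U₄^{ℤ³} ≤ 0`), Messager–Miracle-Solé-monotone along the axis, obey two-sided pure power
  bounds `c‖x‖⁻¹ ≤ G₂(0,x) ≤ C‖x‖⁻¹` (the shape `HasIsingEtaBounds 3 0`: the Simon–Lieb /
  Fröhlich–Simon–Spencer window `criticalTwoPoint_bounds` collapsed onto its infrared edge `η = 0`, which
  forces WINDOW with the extreme admissible room `ε = 1/2`), and whose limit is moreover Möbius covariant
  with `Δ = 1/2`, the conclusion fails. Witness: `gffLattice (1/2)`, the massless free field of `ℝ³` read
  on `ℤ³` (`G₂(0,x) = ‖x‖₂⁻¹`).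

Consequence for provers (both lines `birth` / `backbone_thinning_window` comply): the proof must use a
property of the critical Ising MEASURE that is invisible in these predicates — in the tree's language a
quantitative lower bound on lattice merging, `-U₄^{ℤ³} ≥ c·S₂S₂` at macroscopic quadruples
(0636 `Cruxes/IsingEuclidUpgradeR4NonGaussian/Disproof.lean` §C `LatticeU4RatioPositive`; stubs
`stub_windowLatticeMeetingRobustness`, `stub_backboneFat`). For the Wick witnesses here that ratio is
identically `0` on the lattice although every two-point hypothesis of either line holds.
-/

noncomputable section

namespace Summit.CriticalPhenomena.Ising3DConformalLimit.WindowForcesU4Negative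

open Literature.Probability.LatticeModels Filter Topology
open Summit.CriticalPhenomena.Ising3DConformalLimit.GaussianLimitNotScreenedNegative
  (ι ι_apply ι_zero ι_add norm_le_norm_ι norm_ι_sq_le gffLattice gffLattice_hasLimit)

/-! ## The crux for an arbitrary lattice family -/

/-- WINDOW along `e₁` for the two-point function `G 2 ![0, ·]` of a lattice family: between two scales
`m ≤ n` it never loses more than the power `3/2 - ε`. For `G = criticalCorr 3` this is the antecedent of
the crux (item `WindowBelowHalf`, stmt-CriticalPhenomena-5507). [folklore] -/
def LatticeWindow (G : LatticeCorrFamily 3) : Prop :=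
  ∃ ε c : ℝ, 0 < ε ∧ 0 < c ∧ ∀ m n : ℕ, 1 ≤ m → m ≤ n →
    c * ((n : ℝ) / m) ^ (-((3:ℝ) / 2 - ε)) * G 2 ![0, Pi.single 0 (m : ℤ)] ≤ G 2 ![0, Pi.single 0 (n : ℤ)]

/-- The crux `WindowForcesU4` with `criticalCorr 3` replaced by an arbitrary lattice family `G`
(model-blind form). [folklore] -/
def WindowForcesU4For (G : LatticeCorrFamily 3) : Prop :=
  LatticeWindow G → ∀ (ρ : ℝ → ℝ) (S : CorrFamily 3), (∀ δ ∈ Set.Ioc (0:ℝ) 1, 0 < ρ δ) →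
    HasPointwiseScalingLimit G ρ S → IsNondegenerateTwoPoint S → HasNontrivialU4 S

/-- The crux IS its model-blind form at `G = criticalCorr 3` (`criticalTwoPoint 3 x = criticalCorr 3 2 ![0,x]`).
[folklore] -/
theorem windowForcesU4_iff_for_criticalCorr :
    Theses.CoerciveSharpness.WindowForcesU4 ↔ WindowForcesU4For (criticalCorr 3) := by
  simp only [Theses.CoerciveSharpness.WindowForcesU4, WindowForcesU4For, LatticeWindow, criticalCorr_two]

/-! ## The sampled generalised free field satisfies WINDOW with equality -/

/-- `ι (m e₁) = m e₀`. [folklore] -/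
theorem ι_single_natCast (m : ℕ) :
    ι (Pi.single 0 (m : ℤ)) = EuclideanSpace.single (0 : Fin 3) (m : ℝ) := by
  ext j
  by_cases hj : j = 0
  · subst hj; simp
  · simp [hj]

/-- `‖ι (m e₁)‖₂ = m`. [folklore] -/
theorem norm_ι_single_natCast (m : ℕ) : ‖ι (Pi.single 0 (m : ℤ))‖ = m := by
  rw [ι_single_natCast]
  simp

/-- The axial two-point function of `gffLattice Δ`: `G₂(0, m e₁) = m^{-2Δ}`. [folklore] -/
theorem gffLattice_two_axis (Δ : ℝ) (m : ℕ) :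
    gffLattice Δ 2 ![0, Pi.single 0 (m : ℤ)] = (m : ℝ) ^ (-(2 * Δ)) := by
  show gffTwo Δ (ι 0) (ι (Pi.single 0 (m : ℤ))) = _
  rw [gffTwo, ι_zero, zero_sub, norm_neg, norm_ι_single_natCast]

/-- **`gffLattice Δ` satisfies WINDOW for every `Δ < 3/4`**, with room `ε = 3/2 - 2Δ`, constant `c = 1`
and EQUALITY: `(n/m)^{-2Δ} m^{-2Δ} = n^{-2Δ}`. [folklore] -/
theorem gffLattice_latticeWindow {Δ : ℝ} (hΔ : Δ < 3 / 4) : LatticeWindow (gffLattice Δ) := by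
  refine ⟨3 / 2 - 2 * Δ, 1, by linarith, one_pos, fun m n hm _ => ?_⟩
  have hm0 : (0 : ℝ) < m := by exact_mod_cast hm
  have he : -((3:ℝ) / 2 - (3 / 2 - 2 * Δ)) = -(2 * Δ) := by ring
  rw [gffLattice_two_axis, gffLattice_two_axis, he, one_mul,
    Real.div_rpow (Nat.cast_nonneg n) hm0.le, div_mul_cancel₀ _ (Real.rpow_pos_of_pos hm0 _).ne']

/-- **The crux is false for `gffLattice Δ`, every `Δ < 3/4`** (in particular on the whole Ising window
`[1/2, 3/4)`): WINDOW holds, `gffFamily Δ` is a non-degenerate pointwise limit, and `U₄ ≡ 0`. [folklore] -/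
theorem not_windowForcesU4For_gffLattice {Δ : ℝ} (hΔ : Δ < 3 / 4) : ¬ WindowForcesU4For (gffLattice Δ) :=
  fun h => not_hasNontrivialU4_gff Δ
    (h (gffLattice_latticeWindow hΔ) (fun δ => δ ^ (-Δ)) (gffFamily Δ)
      (fun _ hδ => Real.rpow_pos_of_pos hδ.1 _) (gffLattice_hasLimit Δ) (isNondegenerateTwoPoint_gff Δ))

/-- **No model-blind proof of the crux**: `WindowForcesU4For G` fails for some lattice family `G`
(the free field `gffLattice (1/2)`), so a proof of `WindowForcesU4 = WindowForcesU4For (criticalCorr 3)` must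
use the Ising measure beyond its two-point function and the existence of the limit. [folklore] -/
theorem not_forall_windowForcesU4For : ¬ ∀ G : LatticeCorrFamily 3, WindowForcesU4For G :=
  fun h => not_windowForcesU4For_gffLattice (by norm_num : (1:ℝ) / 2 < 3 / 4) (h _)

/-! ## Sharpening: Ising-like two-point and algebraic structure does not help -/

/-- The two-point kernel of `gffLattice (1/2)` is the Coulomb kernel `‖a - b‖₂⁻¹`. [folklore] -/
theorem gffLattice_half_two (a b : Site 3) : gffLattice (1 / 2) 2 ![a, b] = ‖ι a - ι b‖⁻¹ := by
  show gffTwo (1 / 2) (ι a) (ι b) = _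
  rw [gffTwo, show -(2 * (1 / 2 : ℝ)) = -1 by norm_num, Real.rpow_neg_one]

/-- The four-point function of `gffLattice Δ` is the Wick sum of its two-point function (Gaussian ON THE
LATTICE: `U₄^{ℤ³} ≡ 0`). [folklore] -/
theorem gffLattice_wick (Δ : ℝ) (y : Fin 4 → Site 3) :
    gffLattice Δ 4 y = gffLattice Δ 2 ![y 0, y 1] * gffLattice Δ 2 ![y 2, y 3] +
      gffLattice Δ 2 ![y 0, y 2] * gffLattice Δ 2 ![y 1, y 3] +
      gffLattice Δ 2 ![y 0, y 3] * gffLattice Δ 2 ![y 1, y 2] := rfl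

/-- `gffLattice Δ` is translation invariant on the lattice. [folklore] -/
theorem gffLattice_translation (Δ : ℝ) (n : ℕ) (v : Site 3) (y : Fin n → Site 3) :
    gffLattice Δ n (fun i => y i + v) = gffLattice Δ n y := by
  match n with
  | 0 => rfl
  | 1 => rfl
  | 2 =>
    show gffTwo Δ _ _ = gffTwo Δ _ _
    simp only [ι_add, gffTwo_add]
  | 3 => rfl
  | 4 =>
    show gffTwo Δ _ _ * gffTwo Δ _ _ + gffTwo Δ _ _ * gffTwo Δ _ _ + gffTwo Δ _ _ * gffTwo Δ _ _ =
      gffTwo Δ _ _ * gffTwo Δ _ _ + gffTwo Δ _ _ * gffTwo Δ _ _ + gffTwo Δ _ _ * gffTwo Δ _ _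
    simp only [ι_add, gffTwo_add]
  | _ + 5 => rfl

/-- `gffLattice Δ` is pair-symmetric. [folklore] -/
theorem gffLattice_symm (Δ : ℝ) (a b : Site 3) : gffLattice Δ 2 ![a, b] = gffLattice Δ 2 ![b, a] := by
  show gffTwo Δ (ι a) (ι b) = gffTwo Δ (ι b) (ι a)
  rw [gffTwo, gffTwo, norm_sub_rev]

/-- `gffLattice Δ` has vanishing odd correlators. [folklore] -/
theorem gffLattice_odd (Δ : ℝ) (n : ℕ) (hn : Odd n) (y : Fin n → Site 3) : gffLattice Δ n y = 0 := by
  match n, hn with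
  | 0, hn => exact absurd hn (by decide)
  | 1, _ => rfl
  | 2, hn => exact absurd hn (by decide)
  | 3, _ => rfl
  | 4, hn => exact absurd hn (by decide)
  | _ + 5, _ => rfl

/-- Messager–Miracle-Solé-type monotonicity along the axis for `gffLattice Δ`, `0 ≤ Δ`. [folklore] -/
theorem gffLattice_axis_antitone {Δ : ℝ} (hΔ : 0 ≤ Δ) {m n : ℕ} (hm : 1 ≤ m) (hmn : m ≤ n) :
    gffLattice Δ 2 ![0, Pi.single 0 (n : ℤ)] ≤ gffLattice Δ 2 ![0, Pi.single 0 (m : ℤ)] := by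
  rw [gffLattice_two_axis, gffLattice_two_axis]
  have hm0 : (0 : ℝ) < m := by exact_mod_cast hm
  exact Real.rpow_le_rpow_of_nonpos hm0 (by exact_mod_cast hmn) (by linarith)

/-- `‖ι x‖₂ ≤ 2‖x‖_∞` (from `‖ι x‖² ≤ 3‖x‖²`). [folklore] -/
theorem norm_ι_le_two_mul (x : Site 3) : ‖ι x‖ ≤ 2 * ‖x‖ := by
  have h := norm_ι_sq_le x
  have h0 : 0 ≤ ‖x‖ := norm_nonneg _
  nlinarith [norm_nonneg (ι x)]

/-- **`gffLattice (1/2)` obeys two-sided pure power bounds with the infrared exponent**: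
`(1/2)‖x‖⁻¹ ≤ G₂(0,x) ≤ ‖x‖⁻¹` for `x ≠ 0` (sup norm) — the shape `HasIsingEtaBounds 3 0`
(`IsPowerBounded · (3 - 2 + 0)`). [folklore] -/
theorem gffLattice_half_isPowerBounded :
    IsPowerBounded (fun x : Site 3 => gffLattice (1 / 2) 2 ![0, x]) 1 := by
  refine ⟨1 / 2, 1, by norm_num, fun x hx => ?_⟩
  have ht : (0:ℝ) < ‖x‖ := norm_pos_iff.2 hx
  have h1 : ‖x‖ ≤ ‖ι x‖ := norm_le_norm_ι x
  have h2 : ‖ι x‖ ≤ 2 * ‖x‖ := norm_ι_le_two_mul x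
  have hι : (0:ℝ) < ‖ι x‖ := lt_of_lt_of_le ht h1
  simp only [gffLattice_half_two, ι_zero, zero_sub, norm_neg, Real.rpow_neg_one]
  constructor
  · rw [show (1 / 2 : ℝ) * ‖x‖⁻¹ = (2 * ‖x‖)⁻¹ by rw [mul_inv]; norm_num]
    exact inv_anti₀ hι h2
  · rw [one_mul]
    exact inv_anti₀ ht h1

/-- The crux restricted to ISING-LIKE lattice families: translation invariant, pair-symmetric, odd-free,
Gaussian on the lattice (Wick identity at order four, so `U₄^{ℤ³} ≡ 0 ≤ 0` as Lebowitz' inequality demands),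
monotone along the axis (Messager–Miracle-Solé), inside the two-sided infrared-edge window
`c‖x‖⁻¹ ≤ G₂(0,x) ≤ C‖x‖⁻¹` (`HasIsingEtaBounds 3 0`-shape, which implies WINDOW with `ε = 1/2`), and —
on the limit side — with a Möbius covariant limit of dimension `Δ = 1/2`. [folklore] -/
def WindowForcesU4ForIsingLike : Prop :=
  ∀ G : LatticeCorrFamily 3,
    (∀ n (v : Site 3) (y : Fin n → Site 3), G n (fun i => y i + v) = G n y) →
    (∀ a b : Site 3, G 2 ![a, b] = G 2 ![b, a]) →
    (∀ n, Odd n → ∀ y : Fin n → Site 3, G n y = 0) →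
    (∀ y : Fin 4 → Site 3, G 4 y = G 2 ![y 0, y 1] * G 2 ![y 2, y 3] +
      G 2 ![y 0, y 2] * G 2 ![y 1, y 3] + G 2 ![y 0, y 3] * G 2 ![y 1, y 2]) →
    (∀ m n : ℕ, 1 ≤ m → m ≤ n → G 2 ![0, Pi.single 0 (n : ℤ)] ≤ G 2 ![0, Pi.single 0 (m : ℤ)]) →
    IsPowerBounded (fun x : Site 3 => G 2 ![0, x]) 1 →
    LatticeWindow G →
    ∀ (ρ : ℝ → ℝ) (S : CorrFamily 3), (∀ δ ∈ Set.Ioc (0:ℝ) 1, 0 < ρ δ) →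
      HasPointwiseScalingLimit G ρ S → IsNondegenerateTwoPoint S → IsMoebiusCovariant (1 / 2) S →
      HasNontrivialU4 S

/-- **Even the Ising-like model-blind crux is FALSE** (witness `gffLattice (1/2)`, the massless free field of
`ℝ³` read on `ℤ³`, limit `gffFamily (1/2)` under `ρ δ = δ^{-1/2}`). [folklore] -/
theorem not_windowForcesU4ForIsingLike : ¬ WindowForcesU4ForIsingLike := fun h =>
  not_hasNontrivialU4_gff (1 / 2)
    (h (gffLattice (1 / 2)) (gffLattice_translation _) (gffLattice_symm _) (gffLattice_odd _)
      (gffLattice_wick _) (fun _ _ hm hmn => gffLattice_axis_antitone (by norm_num) hm hmn)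
      gffLattice_half_isPowerBounded (gffLattice_latticeWindow (by norm_num))
      (fun δ => δ ^ (-(1 / 2 : ℝ))) (gffFamily (1 / 2)) (fun _ hδ => Real.rpow_pos_of_pos hδ.1 _)
      (gffLattice_hasLimit _) (isNondegenerateTwoPoint_gff _) (isMoebiusCovariant_gff _))

end Summit.CriticalPhenomena.Ising3DConformalLimit.WindowForcesU4Negative
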